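import Literature.MathematicalPhysics.KineticTheory.HardSphereEulerProofs
import Literature.Analysis.FluidPDE.MVRelativeEnergyPointwiseBounds
import HarnessLib

/-!
# Route `BoxDissipativeWeakStrong` — posited objects (box fields, cut thermodynamics, clamped
entropy balance)

Objects — no statements, no facts — shared by the stub files and the composition of the crux
`Summit.AtomisticToContinuum.HydrodynamicLimit.Theses.BoxDissipativeWeakStrong.EntropyAdmissibility`
(item stmt-AtomisticToContinuum-9903, line `registered` = `Cruxes/EntropyAdmissibility/Lines/birth.lean`)
and reusable by the sibling crux `FluxClosure` (same frame). They are VERBATIM the `let`-bound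
quantities of the route's crux statements, given names:

* `BDWS.FlowFamily σ` — a family of hard-sphere flows of `N + 1` spheres of diameter
  `σ (N+1)^{-1/3}` on `𝕋³` (the crux's `Φ`);
* `BDWS.boxKernel ℓ x y = ℓ⁻³ 𝟙{∀ i, ‖yᵢ − xᵢ‖ < ℓ/2}` (the crux's `K`), and the BOX FIELDS
  `boxDensity`, `boxMomentum`, `boxEnergy` (the crux's `Dn`, `Mm`, `En`: empirical density /
  momentum / energy of `Φ_t z` tested against `K_{ℓ_N}(x, ·)`);
* `BDWS.boxTemp r m E = ⅔ (E/r − |m|²/(2r²))` (the crux's `Th`), the Gibbs-consistent cut excess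
  free energy `cutExcessFreeEnergy η₁ η = f_ex(min η η₁) + (Z(η₁) − 1) log (max η η₁ / η₁)`
  (the crux's `Fc`), the cut entropy per particle `cutEntropy σ η₁ r ϑ = 3/2 log ϑ − log r −
  F_cut(r σ³)` (the crux's `Sc`), and the clamped box entropy `boxClampedEntropy` — the clamp
  `Z_{a,b}(s) = max a (min s b)` (Březina–Feireisl 2018, §3.2) is the tree's
  `Literature.Analysis.FluidPDE.CompressibleEuler.clamp` (reused, not redefined);
* the three pieces of the crux's entropy-balance functional: the DYNAMIC part `dynPart`
  (`∫_{(0,τ]}∫ (ρ̂ Z(ŝ) ∂_tφ + Z(ŝ) m̂·∇φ) dx dt − ∫ ρ̂_τ Z(ŝ_τ) φ_τ dx`), the INITIAL part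
  `initPart` (`∫ ρ̂_0 Z(ŝ_0) φ_0 dx`) and the deterministic INITIAL LIMIT `initLimit`
  (`∫ ρ(0,x) Z(s_cut(ρ(0,x), θ(0,x))) φ(0,x) dx` on the Euler data).

Plus unfolding / elementary API (the `1`-Lipschitz estimate of the clamp, the identity
`boxTemp ρ (ρ • u) (E(ρ,u,θ)) = θ`), packaged as the registered bookkeeping stub `stub_objects :
Sig.stub_objects` that anchors this module to the crux item.

Lean conventions (documented junk, inherited verbatim from the crux): `x / 0 = 0`,
`Real.log 0 = 0`, the `limsup`-defined `hsExcessFreeEnergy`, Bochner integrals `0` on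
non-integrable integrands. Nothing here restates the crux, the route's items or the Statement.

References: J. Březina, E. Feireisl, *Measure-valued solutions to the complete Euler system*,
J. Math. Soc. Japan 70 (2018), Def. 2.9, §3.2 (renormalised entropy inequality, clamps);
H. Spohn, *Large Scale Dynamics of Interacting Particles* (1991), Part I Ch. 3 (box fields).
-/

noncomputable section

open MeasureTheory Filter Set
open scoped ENNReal Topology

namespace Summit.AtomisticToContinuum.HydrodynamicLimit.Theorems.BDWS

open Literature.MathematicalPhysics.KineticTheory
open Literature.Analysis.FluidPDE.CompressibleEuler (clamp)

/-! ## Box fields -/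

/-- A family of hard-sphere flows of `N + 1` spheres of diameter `σ(N+1)^{-1/3}` on `𝕋³`
(the `Φ` of the route's crux statements). -/
abbrev FlowFamily (σ : ℝ) : Type :=
  (N : ℕ) → Literature.Analysis.FluidPDE.HardSphereFlow
    (Literature.Analysis.FluidPDE.Torus.geometry (Fin 3)) (hsDiameter σ N) (N + 1)

/-- The box kernel `K_ℓ(x, y) = ℓ⁻³ 𝟙{∀ i, ‖y_i − x_i‖ < ℓ/2}` (the crux's `K`). -/
def boxKernel (l : ℝ) (x y : T3) : ℝ :=
  indicator {y' : T3 | ∀ i, ‖y' i - x i‖ < l / 2} (fun _ => (l ^ 3)⁻¹) y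

/-- Box density `ρ̂_N(t, z, x)` at window `ℓ_N` (the crux's `Dn`). -/
def boxDensity (σ : ℝ) (ℓ : ℕ → ℝ) (Φ : FlowFamily σ) (N : ℕ) (t : ℝ)
    (z : Literature.Analysis.FluidPDE.Config (N + 1) (Fin 3) T3) (x : T3) : ℝ :=
  empiricalDensityField ((Φ N).flow t z) (boxKernel (ℓ N) x)

/-- Box momentum `m̂_N(t, z, x)` (the crux's `Mm`). -/
def boxMomentum (σ : ℝ) (ℓ : ℕ → ℝ) (Φ : FlowFamily σ) (N : ℕ) (t : ℝ)
    (z : Literature.Analysis.FluidPDE.Config (N + 1) (Fin 3) T3) (x : T3) : V3 :=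
  empiricalMomentumField ((Φ N).flow t z) (boxKernel (ℓ N) x)

/-- Box energy `Ê_N(t, z, x)` (the crux's `En`). -/
def boxEnergy (σ : ℝ) (ℓ : ℕ → ℝ) (Φ : FlowFamily σ) (N : ℕ) (t : ℝ)
    (z : Literature.Analysis.FluidPDE.Config (N + 1) (Fin 3) T3) (x : T3) : ℝ :=
  empiricalEnergyField ((Φ N).flow t z) (boxKernel (ℓ N) x)

/-! ## Cut thermodynamics and the clamp -/

/-- Box temperature `θ̂ = ⅔(Ê/ρ̂ − |m̂|²/(2ρ̂²))` (the crux's `Th`; junk `x / 0 = 0`). -/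
def boxTemp (r : ℝ) (m : V3) (E : ℝ) : ℝ :=
  2 / 3 * (E / r - ‖m‖ ^ 2 / (2 * r ^ 2))

/-- The Gibbs-consistent cut excess free energy
`F_cut(η) = f_ex(min η η₁) + (Z(η₁) − 1) log(max η η₁ / η₁)` (the crux's `Fc`). -/
def cutExcessFreeEnergy (η₁ η : ℝ) : ℝ :=
  hsExcessFreeEnergy (min η η₁) + (hsCompressibility η₁ - 1) * Real.log (max η η₁ / η₁)

/-- The cut entropy per particle `s_cut(r, ϑ) = 3/2 log ϑ − log r − F_cut(r σ³)` (the crux's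
`Sc`; junk `Real.log 0 = 0`). -/
def cutEntropy (σ η₁ r ϑ : ℝ) : ℝ :=
  3 / 2 * Real.log ϑ - Real.log r - cutExcessFreeEnergy η₁ (r * σ ^ 3)

/-- The clamped box entropy `Z_{a,b}(ŝ_N(t, z, x))`, `ŝ = s_cut(ρ̂, θ̂(ρ̂, m̂, Ê))`
(`Z_{a,b} = Literature.Analysis.FluidPDE.CompressibleEuler.clamp a b`). -/
def boxClampedEntropy (σ η₁ : ℝ) (ℓ : ℕ → ℝ) (Φ : FlowFamily σ) (a b : ℝ) (N : ℕ) (t : ℝ)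
    (z : Literature.Analysis.FluidPDE.Config (N + 1) (Fin 3) T3) (x : T3) : ℝ :=
  clamp a b (cutEntropy σ η₁ (boxDensity σ ℓ Φ N t z x)
    (boxTemp (boxDensity σ ℓ Φ N t z x) (boxMomentum σ ℓ Φ N t z x) (boxEnergy σ ℓ Φ N t z x)))

/-! ## The pieces of the clamp-renormalised entropy balance -/

/-- **Dynamic part** `A_N(z) = ∫_{(0,τ]}∫(ρ̂ Z(ŝ) ∂_tφ + Z(ŝ) m̂·∇φ) dx dt − ∫ ρ̂_τ Z(ŝ_τ) φ_τ dx` of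
the crux's entropy-balance functional (its first two summands, verbatim). -/
def dynPart (σ η₁ T : ℝ) (ℓ : ℕ → ℝ) (Φ : FlowFamily σ) (τ a b : ℝ) (φ : ℝ → T3 → ℝ) (N : ℕ)
    (z : Literature.Analysis.FluidPDE.Config (N + 1) (Fin 3) T3) : ℝ :=
  (∫ t in Ioc 0 τ, ∫ x, (boxDensity σ ℓ Φ N t z x * boxClampedEntropy σ η₁ ℓ Φ a b N t z x *
        Literature.Analysis.FunctionSpaces.Torus.timeDerivWithin (Ico 0 T) φ t x +
      boxClampedEntropy σ η₁ ℓ Φ a b N t z x *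
        inner ℝ (boxMomentum σ ℓ Φ N t z x) (Literature.Analysis.FunctionSpaces.Torus.gradient (φ t) x))) -
    (∫ x, boxDensity σ ℓ Φ N τ z x * boxClampedEntropy σ η₁ ℓ Φ a b N τ z x * φ τ x)

/-- **Initial part** `B_N(z) = ∫ ρ̂_0 Z(ŝ_0) φ_0 dx` (the crux's third summand, verbatim). -/
def initPart (σ η₁ : ℝ) (ℓ : ℕ → ℝ) (Φ : FlowFamily σ) (a b : ℝ) (φ : ℝ → T3 → ℝ) (N : ℕ)
    (z : Literature.Analysis.FluidPDE.Config (N + 1) (Fin 3) T3) : ℝ :=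
  ∫ x, boxDensity σ ℓ Φ N 0 z x * boxClampedEntropy σ η₁ ℓ Φ a b N 0 z x * φ 0 x

/-- **Initial limit** `B = ∫ ρ(0,x) Z_{a,b}(s_cut(ρ(0,x), θ(0,x))) φ(0,x) dx`: the clamped cut
entropy of the Euler initial data tested with `φ(0,·)` (deterministic). -/
def initLimit (σ η₁ : ℝ) (ρ θ : ℝ → T3 → ℝ) (a b : ℝ) (φ : ℝ → T3 → ℝ) : ℝ :=
  ∫ x, ρ 0 x * clamp a b (cutEntropy σ η₁ (ρ 0 x) (θ 0 x)) * φ 0 x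

/-! ## Elementary API -/

/-- Unfolding lemma for `boxKernel`. -/
theorem boxKernel_apply (l : ℝ) (x y : T3) :
    boxKernel l x y = indicator {y' : T3 | ∀ i, ‖y' i - x i‖ < l / 2} (fun _ => (l ^ 3)⁻¹) y :=
  rfl

/-- The clamp `Literature.Analysis.FluidPDE.CompressibleEuler.clamp` is `1`-Lipschitz. -/
theorem abs_clamp_sub_clamp_le (a b s s' : ℝ) : |clamp a b s - clamp a b s'| ≤ |s - s'| := by
  unfold Literature.Analysis.FluidPDE.CompressibleEuler.clamp
  have h1 : |min s b - min s' b| ≤ |s - s'| := abs_min_sub_min_le_max s b s' b |>.trans (by simp)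
  exact (abs_max_sub_max_le_max a (min s b) a (min s' b)).trans (by simpa using h1)

/-- The box temperature of the conserved state `(ρ, ρu, E(ρ,u,θ))` is `θ` (for `ρ ≠ 0`). -/
theorem boxTemp_consState {ρ : ℝ} (hρ : ρ ≠ 0) (u : V3) (θ : ℝ) :
    boxTemp ρ (ρ • u) (totalEnergyDensity ρ u θ) = θ := by
  unfold boxTemp totalEnergyDensity
  rw [norm_smul, Real.norm_eq_abs, mul_pow, sq_abs]
  field_simp
  ring

/-! ## Bookkeeping stub (anchors this objects module to the crux item for `--supports`) -/

/-- Signature of the bookkeeping stub `stub_objects` of the line `registered` of the crux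
stmt-AtomisticToContinuum-9903: the clamp is `1`-Lipschitz and the box temperature of a conserved
state is its temperature. -/
def Sig.stub_objects : Prop :=
  (∀ a b s s' : ℝ, |clamp a b s - clamp a b s'| ≤ |s - s'|) ∧
    ∀ ρ : ℝ, ρ ≠ 0 → ∀ (u : V3) (θ : ℝ), boxTemp ρ (ρ • u) (totalEnergyDensity ρ u θ) = θ

/-- **Registered bookkeeping stub `stub_objects`** (crux stmt-AtomisticToContinuum-9903, line
`registered`): packaged elementary API of the objects. -/
theorem stub_objects : Sig.stub_objects :=
  ⟨abs_clamp_sub_clamp_le, fun _ hρ u θ => boxTemp_consState hρ u θ⟩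

end Summit.AtomisticToContinuum.HydrodynamicLimit.Theorems.BDWS

end
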